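import Summits.QuantumFields.BalabanUV.Beta.GAN24.CombBornLambdaContactLineage
import Summits.QuantumFields.BalabanUV.Beta.GAN24.CombBornLambdaContactCells
import Summits.QuantumFields.BalabanUV.Beta.GAN24.CombBornLambdaGaugeBlind
import Summits.QuantumFields.BalabanUV.Beta.GAN24.CombLegEnvelope
import Summits.QuantumFields.BalabanUV.Beta.GAN24.BornLambdaContactBound

/-!
# `BalabanUV.Beta.GAN24.CombBornLambdaContactBound` — binder row G-an2-4 ∕ (CONV-C), TRANSFER-III, the (III′) S-slot (b) of the END `CombChargeRowsClosed`: **THE BORN-Λ CONTACT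
# LETTER `hCg′` OF road-P2 M.104 IS A THEOREM FROM `2 ≤ Lc` ALONE** (`d = 3`; every weight base at the pin `|cE| ≤ Lc^4`, every `cΛ`, every sym-table record `tabs.H = symHessFFAt ρ_t Lc`
# at an in-block root, every pair of in-block leg roots; then the centred leg roots `ctrOff ∕ ctr` of the comb chart = M.104's third hypothesis LITERALLY, `p = 1`, `θ = Lc⁻¹`) — the twin
# of leaf-02 g49's (E) END `BornLambdaContactBound.exists_hCg_three`: MY PART 1 count `CombBornLambdaContactLineage.abs_weight_mul_comb_contact_le_three` with every letter DISCHARGED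
# from the tree — (N1) `RespStepDecay.exists_respStep_decay_and_grad`, the OWNER's conjugated envelope `CombLegEnvelope.exists_legChain_psiLeg_envelope` and born-Λ bracket letters for
# the conjugated legs `CombBornLambdaGaugeBlind.exists_bracket_bornLam_zero∕succ_letter_comb_three` (W54c §4), MY g89 gauge envelope `CombContactGaugeStaircase.abs_combGauge_le`, the
# (E) coefficient letters `BornLambdaContactCells.exists_abs_bornLamCoeff_zero_le ∕ abs_bornLamCoeff_succ_le_of_unitDecayK` (road P1's `unitDecayK_holds`), MY `CombBornLambdaContactCells`
# (table identities at the record, transversality at the sym table)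
# (G-an2-4 CRUX TEAM (2), leaf prover `b2b-balaban-gan24-formalise-leaf-01`, gen 90)

WHAT IS PROVED (`d = 3`, `2 ≤ Lc`; [folklore] bookkeeping over the named tree theorems):
* **`exists_comb_hCg_three`** — `∃ C θ δ`, `θ = Lc⁻¹`, such that for EVERY sym-table record `tabs` (`tabs.H` ff-valued, `= symHessFFAt (toSite rt) Lc`, `rt ∈ box`), EVERY corrector root
  `r ∈ box` and dressing root `rl ∈ box`, and EVERY lineage `i < k`:
  `LocStencil (fun κ′ u′ ↦ (cE·Lc^8)^{k−i} • (push₃ T′_i T′_i T′_i S_i − push₃ B_i B_i B_i S_i) κ′ u′) (C·((k−i)^1·θ^{k−i})) δ`,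
  `T′_i = legChain (j ↦ legComp ψ♭_r (respStepBmSeq ρ_l Lc j)) i (k−1−i)`, `B_i = respStep (Lc^i) (Lc^k)`, `S_i = unitS_i (combFreshAt tabs 0 cΛ i)`.
* **`exists_comb_hCg_ctr`** — the same at `r = rl = ctrOff (3+1) Lc` (`ctr (3+1) Lc = toSite (ctrOff (3+1) Lc)` by `rfl`): LITERALLY the hypothesis `hCg` (with `p = 1`) of road-P2 M.104
  `CombSRowsOfContactLetters.exists_hS_hSall_ScombOf_of_contactLetters` ∕ MY `CombSRowsOfFourContactLetters` ∕ the OWNER's S54c `CombChargeRowsOfBornContactLetters`.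
WHAT THIS DISCHARGES AND WHAT NOT: ONE of the four remaining S-slot contact letters of the (III′) END (the born-Λ CONTACT letter); NOT the born-Λ pair `hPc`, NOT the born-V letters
`hCv ∕ hPcV`, hence NOT `(hS, hSall)` and NOT the END by itself.

NOT IN PRINT; OUR PROOF ([folklore] bookkeeping BY NAME; 0 `def`, 0 cited fact, 0 `def … : Prop`, 0 sorry, no hypothesis beyond `2 ≤ Lc`, the pin `|cE| ≤ Lc^4` and the record
identity `tabs.H = symHessFFAt ρ_t Lc`).  HONEST FRAMING (cell contract, verbatim): «discharging `BetaPertH` makes Bałaban's UV stability UNCONDITIONAL — a real constructive-QFT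
result; it is NOT the continuum limit and NOT the Clay problem.»  HONEST DEPENDENCY (verbatim): «continuum YM on T⁴ ⇐ BetaPertH ∧ nine spine estimates (0/9 proved); BetaPertH ⇐ (D1) ∧
(D4) ∧ CAP+tail; G-an2-4 gates asym, D1 and NE2/3/4.»  NEVER «G-an2-4 closed» as (CONV-C); NOT D1, NOT `BetaPertH`, NOT continuum, NOT Clay.  2026-08-28; no existing file touched.
-/

noncomputable section

open Finset
open scoped BigOperators
open Literature.MathematicalPhysics.QuantumFieldTheory
open Literature.MathematicalPhysics.QuantumFieldTheory.LatticeForm (quo)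
open Literature.MathematicalPhysics.QuantumFieldTheory.Balaban1983to89
open Literature.MathematicalPhysics.QuantumFieldTheory.Balaban1983to89.Beta
open B4ContourShift (supNorm supNorm_nonneg)
open B12Sec2to5 (l1 l1_nonneg)
open ExpKernelCalculus (MKer Zl Zl_nonneg)
open AffineAveraging (Site box toSite)
open AveragingContoursRooted (ctr ctrOff ctrOff_mem_box)
open AveragingHessianKernels (ell)
open OneStepResolventKernel (Fib LocStencil KInv)
open BalabanStepJetsSucc (E2 lamCoeffK)
open BalabanStepJets (lamCoeffOf)
open BalabanCompositeJets (respStep)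
open KKTFluctuationKernel (delta1)
open Summit.QuantumFields.BalabanUV.Beta.AxialProjectorBlockMean (bmGaugeAt)
open Summit.QuantumFields.BalabanUV.Beta.HessKerDressedUnits (unitS)
open Summit.QuantumFields.BalabanUV.Beta.SymCorrectorKernel (psiKS)
open Summit.QuantumFields.BalabanUV.Beta.SymCorrectorFace (faceWtSum faceWtSum_nonneg)
open Summit.QuantumFields.BalabanUV.Beta.SymAveragingHessianCounts (symHessFFAt)
open Summit.QuantumFields.BalabanUV.Beta.SymmetrisedStepJets (SymTables)
open Summit.QuantumFields.BalabanUV.Beta.GAN24.CombesThomas (sfStep smStep KStepUnit)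
open Summit.QuantumFields.BalabanUV.Beta.GAN24.RespStepBmDecompExact (respStepBmSeq)
open Summit.QuantumFields.BalabanUV.Beta.GAN24.RespStepBmDecompPsi (Psi)
open Summit.QuantumFields.BalabanUV.Beta.GAN24.Push4 (legComp IsFF)
open Summit.QuantumFields.BalabanUV.Beta.GAN24.Push4Iter (legChain)
open Summit.QuantumFields.BalabanUV.Beta.GAN24.Push3 (push₃)
open Summit.QuantumFields.BalabanUV.Beta.GAN24.CombBornSector (combFreshAt)
open Summit.QuantumFields.BalabanUV.Beta.GAN24.StencilSlotOfShapes (locStencil_mono')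
open Summit.QuantumFields.BalabanUV.Beta.GAN24.CombLegChainGauge (PsiFace)
open Summit.QuantumFields.BalabanUV.Beta.GAN24.RespStepDecay (exists_respStep_decay_and_grad)
open Summit.QuantumFields.BalabanUV.Beta.GAN24.UndressedResponseUnits (inv_cast_pow_pow)
open Summit.QuantumFields.BalabanUV.Beta.GAN24.FibreStrip (unitDecayK_holds)
open Summit.QuantumFields.BalabanUV.Beta.GAN24.CombLegEnvelope (exists_legChain_psiLeg_envelope)
open Summit.QuantumFields.BalabanUV.Beta.GAN24.CombContactGaugeStaircase (abs_combGauge_le)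
open Summit.QuantumFields.BalabanUV.Beta.GAN24.BornLambdaContactCells (exists_abs_bornLamCoeff_zero_le abs_bornLamCoeff_succ_le_of_unitDecayK)
open Summit.QuantumFields.BalabanUV.Beta.GAN24.CombBornLambdaContactCells (unitS_combFreshAt_lam_zero_eq_SLam unitS_combFreshAt_lam_succ_eq_SLam divV_combBornLam_zero_eq_zero
  divV_combBornLam_succ_eq_zero)
open Summit.QuantumFields.BalabanUV.Beta.GAN24.CombBornLambdaGaugeBlind (exists_bracket_bornLam_zero_letter_comb_three exists_bracket_bornLam_succ_letter_comb_three)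
open Summit.QuantumFields.BalabanUV.Beta.GAN24.ContactLambdaCellBound (exp_env_mono_rate)
open Summit.QuantumFields.BalabanUV.Beta.GAN24.BornLambdaContactBound (bracket_letter_mono)
open Summit.QuantumFields.BalabanUV.Beta.GAN24.CombBornLambdaContactLineage (abs_weight_mul_comb_contact_le_three)

namespace Summit.QuantumFields.BalabanUV.Beta.GAN24.CombBornLambdaContactBound

variable {Lc : ℕ} [NeZero Lc]

/-- NOT IN PRINT; OUR PROOF (`d = 3`, `2 ≤ Lc`).  **THE (III′) BORN-Λ CONTACT LETTER, ALL ROOTS**: for every `cΛ` and every weight base at the pin `|cE| ≤ Lc^4` there are `C ≥ 0` and `δ > 0`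
such that, with `θ = Lc⁻¹ ∈ [0,1)`, for EVERY sym-table record `tabs` (`tabs.H` ff-valued and `= symHessFFAt (toSite rt) Lc`, `rt ∈ box`), EVERY corrector root `r ∈ box`, EVERY dressing
root `rl ∈ box` and EVERY lineage `i < k`,
`LocStencil (fun κ′ u′ ↦ (cE·Lc^8)^{k−i} • (push₃ T′_i T′_i T′_i S_i − push₃ B_i B_i B_i S_i) κ′ u′) (C·((k−i)^1·θ^{k−i})) δ`.
Letters: (N1); the OWNER's conjugated envelope; MY g89 gauge envelope (face letter `F := Σ_{r′∈box} faceWtSum r′ Lc`); the (E) coefficient letters; MY transversality at the sym table; the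
OWNER's W54c bracket letters for the conjugated legs (one `(C, δ)` for member `0`, one for all members `j+1`, merged by `max ∕ min`); the count is MY PART 1 at the sym table. -/
theorem exists_comb_hCg_three (hLc : 2 ≤ Lc) (cE cΛ : ℝ) (hcE : |cE| ≤ (Lc : ℝ) ^ 4) :
    ∃ C θ δ : ℝ, 0 ≤ C ∧ 0 ≤ θ ∧ θ < 1 ∧ 0 < δ ∧ ∀ (tabs : SymTables 3 Lc), (∀ μ y, IsFF (tabs.H μ y)) →
      ∀ (rt : Fin (3 + 1) → ℕ), rt ∈ box (3 + 1) Lc → tabs.H = symHessFFAt (toSite rt) Lc →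
      ∀ (r : Fin (3 + 1) → ℕ), r ∈ box (3 + 1) Lc → ∀ (rl : Fin (3 + 1) → ℕ), rl ∈ box (3 + 1) Lc → ∀ k i : ℕ, i < k →
      LocStencil (fun κ' u' => (cE * (Lc : ℝ) ^ (2 * (3 + 1))) ^ (k - i) •
        (push₃ (legChain (fun j => legComp (fun α x κ u => psiKS r Lc u x (Sum.inl κ) (Sum.inl α)) (respStepBmSeq (d := 3) (toSite rl) Lc j)) i (k - 1 - i))
            (legChain (fun j => legComp (fun α x κ u => psiKS r Lc u x (Sum.inl κ) (Sum.inl α)) (respStepBmSeq (d := 3) (toSite rl) Lc j)) i (k - 1 - i))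
            (legChain (fun j => legComp (fun α x κ u => psiKS r Lc u x (Sum.inl κ) (Sum.inl α)) (respStepBmSeq (d := 3) (toSite rl) Lc j)) i (k - 1 - i))
            (unitS (sfStep Lc i) (smStep 3 Lc i) (combFreshAt tabs 0 cΛ i)) κ' u'
          - push₃ (respStep (d := 3) (Lc ^ i) (Lc ^ k)) (respStep (d := 3) (Lc ^ i) (Lc ^ k)) (respStep (d := 3) (Lc ^ i) (Lc ^ k))
            (unitS (sfStep Lc i) (smStep 3 Lc i) (combFreshAt tabs 0 cΛ i)) κ' u')) (C * (((k - i : ℕ) : ℝ) ^ 1 * θ ^ (k - i))) δ := by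
  have hLc1 : 1 ≤ Lc := le_trans (by norm_num) hLc
  have hL : (0 : ℝ) < (Lc : ℝ) := Nat.cast_pos.2 (Nat.pos_of_ne_zero (NeZero.ne Lc))
  -- the tree letters, constants outside every ∀
  obtain ⟨κ₁, C₁, -, hκ₁, hC₁, -, hN1raw, -⟩ := exists_respStep_decay_and_grad (Lc := Lc)
  have hN1 : ∀ (m k : ℕ) (μ : Fin (3 + 1)) (z : Site (3 + 1)) (l'' : Fin (3 + 1)) (w' : Site (3 + 1)),
      |respStep (d := 3) (Lc ^ m) (Lc ^ (m + k + 1)) μ z l'' w'| ≤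
        C₁ * ((Lc : ℝ) ^ (5 * (k + 1)))⁻¹ * Real.exp (-(κ₁ * supNorm (quo (Lc ^ (k + 1)) w' - z))) := by
    intro m k μ z l'' w'
    have h := hN1raw m k μ z l'' w'
    rwa [inv_cast_pow_pow] at h
  obtain ⟨κE, KE, hκE, -, hEnv⟩ := exists_legChain_psiLeg_envelope (Lc := Lc) hLc
  obtain ⟨C0, δ0, hC0, hδ0, hb0⟩ := exists_bracket_bornLam_zero_letter_comb_three (Lc := Lc) hLc
  obtain ⟨Cs, δs, hCs, hδs, hbs⟩ := exists_bracket_bornLam_succ_letter_comb_three (Lc := Lc) hLc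
  set Cbr : ℝ := max C0 Cs with hCbr
  set δbr : ℝ := min δ0 δs with hδbr
  have hCbr0 : 0 ≤ Cbr := hC0.trans (le_max_left _ _)
  have hδbr0 : 0 < δbr := lt_min hδ0 hδs
  set κ : ℝ := min δbr κ₁ with hκdef
  have hκ : 0 < κ := lt_min hδbr0 hκ₁
  have hTb : 0 ≤ |cΛ| * Cbr := mul_nonneg (abs_nonneg _) hCbr0
  -- the root-free face letter
  set F : ℝ := ∑ r' ∈ box (3 + 1) Lc, faceWtSum r' Lc with hFdef
  have hFr : ∀ r ∈ box (3 + 1) Lc, faceWtSum r Lc ≤ F := fun r hr =>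
    Finset.single_le_sum (f := fun r' => faceWtSum r' Lc) (fun r' _ => faceWtSum_nonneg r' Lc) hr
  have hF0 : 0 ≤ F := Finset.sum_nonneg fun r' _ => faceWtSum_nonneg r' Lc
  set A : ℝ := (1 + (Lc : ℝ)) * (8 * (Lc : ℝ) + F * (1 + 8 * (Lc : ℝ) * (Real.exp κ₁ + 1))) with hAdef
  have hA0 : 0 ≤ A := by positivity
  -- the constants
  refine ⟨(Lc : ℝ) ^ 3 * ((2 * ((((3 + 1).factorial : ℕ) : ℝ) * (Lc : ℝ) ^ (3 + 1)))⁻¹ * (((3 : ℝ) + 1) * (|cΛ| * Cbr) * (Real.exp (2 * ((3 : ℝ) + 1) * κ) ^ 2 *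
              (((2 * Lc : ℕ) : ℝ) ^ (3 + 1) * (((3 + 1 : ℕ) : ℝ) * ((((3 + 1).factorial : ℕ) : ℝ) * ((Lc : ℝ) ^ (3 + 1) * (ell (3 + 1) Lc : ℝ)))))))
            * (C₁ ^ 2 * (8 * A + 8 * A ^ 2 + 4 * A * Lc + 12 * A ^ 2 * Lc)) * Zl (3 + 1) (κ / (4 * ((3 : ℝ) + 1)))),
    (Lc : ℝ)⁻¹, κ / 12 / ((3 : ℝ) + 1), ?_, (inv_pos.2 hL).le, ?_, by positivity, ?_⟩
  · have hz : 0 ≤ Zl (3 + 1) (κ / (4 * ((3 : ℝ) + 1))) := Zl_nonneg (by positivity)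
    positivity
  · have h2 : (2 : ℝ) ≤ Lc := by exact_mod_cast hLc
    rw [inv_lt_one_iff₀]; right; linarith
  intro tabs hHff rt hrt hH r hr rl hrl k i hik κ' u' x z a b
  obtain ⟨n, rfl⟩ : ∃ n, k = i + n + 1 := ⟨k - i - 1, by omega⟩
  have e1 : i + n + 1 - 1 - i = n := by omega
  have e2 : i + n + 1 - i = n + 1 := by omega
  -- the lineage's letters with explicit constants
  have hE : ∀ μ z' l u, |legChain (fun j => legComp (fun α x κ u => psiKS r Lc u x (Sum.inl κ) (Sum.inl α)) (respStepBmSeq (d := 3) (toSite rl) Lc j)) i n μ z' l u|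
      ≤ (KE * ((n : ℝ) + 1) * ((Lc : ℝ) ^ (4 * (n + 1)))⁻¹) * Real.exp (-(κE * supNorm (quo (Lc ^ (n + 1)) u - z'))) :=
    fun μ z' l u => hEnv r hr rl hrl i n μ z' l u
  have hlam : ∀ μ z' u, |(Psi (toSite rl) Lc i n (delta1 μ z') + PsiFace r (toSite rl) Lc i n (delta1 μ z')
      - bmGaugeAt (toSite rl) (respStep (d := 3) (Lc ^ i) (Lc ^ (i + n + 1)) μ z') Lc) u|
        ≤ (2 * (8 * (Lc : ℝ) * C₁ * ((Lc : ℝ) ^ (5 * (n + 1)))⁻¹ + F * ((1 + 8 * (Lc : ℝ) * (Real.exp κ₁ + 1)) * C₁ * ((Lc : ℝ) ^ (5 * (n + 1)))⁻¹)) *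
          (Lc : ℝ) ^ (n + 1)) := by
    intro μ z' u
    have h := abs_combGauge_le hκ₁.le hC₁ hN1 hr hrl (hFr r hr) hLc i n μ z' u
    rw [Pi.sub_apply, Pi.add_apply]
    refine h.trans ?_
    have hpre : 0 ≤ 2 * (8 * (Lc : ℝ) * C₁ * ((Lc : ℝ) ^ (5 * (n + 1)))⁻¹ + F * ((1 + 8 * (Lc : ℝ) * (Real.exp κ₁ + 1)) * C₁ * ((Lc : ℝ) ^ (5 * (n + 1)))⁻¹)) *
        (Lc : ℝ) ^ (n + 1) := by positivity
    have hexp : Real.exp (-(κ₁ * supNorm (quo (Lc ^ (n + 1)) u - z'))) ≤ 1 :=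
      Real.exp_le_one_iff.2 (neg_nonpos.2 (mul_nonneg hκ₁.le (supNorm_nonneg _)))
    calc _ ≤ (2 * (8 * (Lc : ℝ) * C₁ * ((Lc : ℝ) ^ (5 * (n + 1)))⁻¹ + F * ((1 + 8 * (Lc : ℝ) * (Real.exp κ₁ + 1)) * C₁ * ((Lc : ℝ) ^ (5 * (n + 1)))⁻¹)) *
          (Lc : ℝ) ^ (n + 1)) * 1 := mul_le_mul_of_nonneg_left hexp hpre
      _ = _ := mul_one _
  have hqi : 0 ≤ ((((Lc : ℝ) ^ n) ^ (2 * 3 + 1))⁻¹) := by positivity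
  cases i with
  | zero =>
    -- member 0: coefficients `cΛ·lamCoeffOf (KInv Lc) Lc`
    obtain ⟨Cc, δc, hδc, hCc, hc⟩ := exists_abs_bornLamCoeff_zero_le (d := 3) (Lc := Lc) cΛ
    rw [unitS_combFreshAt_lam_zero_eq_SLam tabs hH]
    have hbr : ∀ (κ' : Fin (3 + 1)) (u' : Site (3 + 1)) μ y,
        |∑' u, ∑ l, legChain (fun j => legComp (fun α x κ u => psiKS r Lc u x (Sum.inl κ) (Sum.inl α)) (respStepBmSeq (d := 3) (toSite rl) Lc j)) 0 n κ' u' l u *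
            (cΛ * lamCoeffOf (KInv (N := Lc) (d := 3)) Lc μ y l u)|
          ≤ |cΛ| * Cbr * ((((Lc : ℝ) ^ n) ^ (2 * 3 + 1))⁻¹) * Real.exp (-(δbr * supNorm (quo (Lc ^ n) y - u'))) := by
      intro κ' u' μ y
      have h := hb0 r hr rl hrl cΛ (0 + n + 1) κ' u' μ y
      rw [show 0 + n + 1 - 1 - 0 = n by omega] at h
      exact bracket_letter_mono (le_max_left _ _) (min_le_left _ _) hqi (supNorm_nonneg _) h
    have H := abs_weight_mul_comb_contact_le_three hLc hr hrl hrt hcE hN1 hκ₁ hC₁ (hFr r hr) hE hκE hlam hc hδc hCc (divV_combBornLam_zero_eq_zero hrt cΛ) hbr hδbr0 hTb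
      κ' u' x z a b
    simpa only [e1, e2, Pi.smul_apply, Pi.sub_apply, smul_eq_mul, pow_one, Nat.cast_succ] using H
  | succ j =>
    -- member j+1: coefficients `(cΛ·Lc^8)·lamCoeffK (KStepUnit Lc (j+1)) ((smStep j)²•E2 (j+1)) Lc`
    obtain ⟨κK, hκK, Cst, hK⟩ := unitDecayK_holds (Lc := Lc)
    have hrate : 0 < κK / ((3 + 1) * (Lc : ℝ)) := by positivity
    have hrate2 : 0 < κK / ((3 + 1) * (Lc : ℝ)) / 2 := by positivity
    have hCc : 0 ≤ |cΛ * (Lc : ℝ) ^ (2 * (3 + 1))| * ((Fintype.card (Fib 3) : ℝ) * (Cst * Real.exp (2 * κK) * (Cst * Real.exp (2 * κK)))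
        * Zl (3 + 1) (κK / ((3 + 1) * (Lc : ℝ)) - κK / ((3 + 1) * (Lc : ℝ)) / 2)) := by
      have hz : 0 ≤ Zl (3 + 1) (κK / ((3 + 1) * (Lc : ℝ)) - κK / ((3 + 1) * (Lc : ℝ)) / 2) := Zl_nonneg (by linarith)
      have hsq : 0 ≤ Cst * Real.exp (2 * κK) * (Cst * Real.exp (2 * κK)) := mul_self_nonneg _
      positivity
    rw [unitS_combFreshAt_lam_succ_eq_SLam tabs hHff hH]
    have hbr : ∀ (κ' : Fin (3 + 1)) (u' : Site (3 + 1)) μ y,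
        |∑' u, ∑ l, legChain (fun j => legComp (fun α x κ u => psiKS r Lc u x (Sum.inl κ) (Sum.inl α)) (respStepBmSeq (d := 3) (toSite rl) Lc j)) (j + 1) n κ' u' l u *
            ((cΛ * (Lc : ℝ) ^ (2 * (3 + 1))) * lamCoeffK (KStepUnit (d := 3) Lc (j + 1)) ((smStep 3 Lc j) ^ 2 • E2 3 Lc (j + 1)) Lc μ y l u)|
          ≤ |cΛ| * Cbr * ((((Lc : ℝ) ^ n) ^ (2 * 3 + 1))⁻¹) * Real.exp (-(δbr * supNorm (quo (Lc ^ n) y - u'))) := by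
      intro κ' u' μ y
      have h := hbs r hr rl hrl cΛ j (j + 1 + n + 1) κ' u' μ y
      rw [show j + 1 + n + 1 - 1 - (j + 1) = n by omega] at h
      exact bracket_letter_mono (le_max_right _ _) (min_le_right _ _) hqi (supNorm_nonneg _) h
    have H := abs_weight_mul_comb_contact_le_three hLc hr hrl hrt hcE hN1 hκ₁ hC₁ (hFr r hr) hE hκE hlam (abs_bornLamCoeff_succ_le_of_unitDecayK (d := 3) hK hrate cΛ j)
      hrate2 hCc (divV_combBornLam_succ_eq_zero hrt cΛ j) hbr hδbr0 hTb κ' u' x z a b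
    simpa only [e1, e2, Pi.smul_apply, Pi.sub_apply, smul_eq_mul, pow_one, Nat.cast_succ] using H

/-- NOT IN PRINT; OUR PROOF (`d = 3`, `2 ≤ Lc`).  **THE (III′) BORN-Λ CONTACT LETTER `hCg′` — LITERALLY road-P2 M.104's THIRD HYPOTHESIS** (with `p = 1`, `θ = Lc⁻¹`): the centred leg
roots `r = rl = ctrOff (3+1) Lc` of the comb chart (`ctr (3+1) Lc = toSite (ctrOff (3+1) Lc)` by `rfl`), the sym-table record `tabs.H = symHessFFAt (toSite rr) Lc` at any in-block root,
every weight base `|cE| ≤ Lc^4` (the pin `cE = Lc^4` included) and every `cΛ`. -/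
theorem exists_comb_hCg_ctr (hLc : 2 ≤ Lc) (tabs : SymTables 3 Lc) (hHff : ∀ μ y, IsFF (tabs.H μ y)) {rr : Fin (3 + 1) → ℕ} (hrr : rr ∈ box (3 + 1) Lc)
    (hH : tabs.H = symHessFFAt (toSite rr) Lc) (cE cΛ : ℝ) (hcE : |cE| ≤ (Lc : ℝ) ^ 4) :
    ∃ C θ δ : ℝ, 0 ≤ C ∧ 0 ≤ θ ∧ θ < 1 ∧ 0 < δ ∧ ∀ k i : ℕ, i < k →
      LocStencil (fun κ' u' => (cE * (Lc : ℝ) ^ (2 * (3 + 1))) ^ (k - i) •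
        (push₃ (legChain (fun j => legComp (fun α x κ u => psiKS (ctrOff (3 + 1) Lc) Lc u x (Sum.inl κ) (Sum.inl α)) (respStepBmSeq (d := 3) (ctr (3 + 1) Lc) Lc j)) i (k - 1 - i))
            (legChain (fun j => legComp (fun α x κ u => psiKS (ctrOff (3 + 1) Lc) Lc u x (Sum.inl κ) (Sum.inl α)) (respStepBmSeq (d := 3) (ctr (3 + 1) Lc) Lc j)) i (k - 1 - i))
            (legChain (fun j => legComp (fun α x κ u => psiKS (ctrOff (3 + 1) Lc) Lc u x (Sum.inl κ) (Sum.inl α)) (respStepBmSeq (d := 3) (ctr (3 + 1) Lc) Lc j)) i (k - 1 - i))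
            (unitS (sfStep Lc i) (smStep 3 Lc i) (combFreshAt tabs 0 cΛ i)) κ' u'
          - push₃ (respStep (d := 3) (Lc ^ i) (Lc ^ k)) (respStep (d := 3) (Lc ^ i) (Lc ^ k)) (respStep (d := 3) (Lc ^ i) (Lc ^ k))
            (unitS (sfStep Lc i) (smStep 3 Lc i) (combFreshAt tabs 0 cΛ i)) κ' u')) (C * (((k - i : ℕ) : ℝ) ^ 1 * θ ^ (k - i))) δ := by
  obtain ⟨C, θ, δ, hC, hθ, hθ1, hδ, h⟩ := exists_comb_hCg_three (Lc := Lc) hLc cE cΛ hcE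
  have hc : ctrOff (3 + 1) Lc ∈ box (3 + 1) Lc := ctrOff_mem_box (by omega)
  exact ⟨C, θ, δ, hC, hθ, hθ1, hδ, fun k i hik => h tabs hHff rr hrr hH _ hc _ hc k i hik⟩

/-- NOT IN PRINT; OUR PROOF (`d = 3`, `2 ≤ Lc`).  **THE SAME AT ANY LOG POWER `p ≥ 1`** (M.104's `hCg` shares its implicit `p` with the born-V letter `hCv`; `(k−i)^1 ≤ (k−i)^p` on
`i < k`, `LocStencil` is monotone in its constant — `locStencil_mono'`). -/
theorem exists_comb_hCg_ctr_pow (hLc : 2 ≤ Lc) (tabs : SymTables 3 Lc) (hHff : ∀ μ y, IsFF (tabs.H μ y)) {rr : Fin (3 + 1) → ℕ} (hrr : rr ∈ box (3 + 1) Lc)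
    (hH : tabs.H = symHessFFAt (toSite rr) Lc) (cE cΛ : ℝ) (hcE : |cE| ≤ (Lc : ℝ) ^ 4) {p : ℕ} (hp : 1 ≤ p) :
    ∃ C θ δ : ℝ, 0 ≤ C ∧ 0 ≤ θ ∧ θ < 1 ∧ 0 < δ ∧ ∀ k i : ℕ, i < k →
      LocStencil (fun κ' u' => (cE * (Lc : ℝ) ^ (2 * (3 + 1))) ^ (k - i) •
        (push₃ (legChain (fun j => legComp (fun α x κ u => psiKS (ctrOff (3 + 1) Lc) Lc u x (Sum.inl κ) (Sum.inl α)) (respStepBmSeq (d := 3) (ctr (3 + 1) Lc) Lc j)) i (k - 1 - i))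
            (legChain (fun j => legComp (fun α x κ u => psiKS (ctrOff (3 + 1) Lc) Lc u x (Sum.inl κ) (Sum.inl α)) (respStepBmSeq (d := 3) (ctr (3 + 1) Lc) Lc j)) i (k - 1 - i))
            (legChain (fun j => legComp (fun α x κ u => psiKS (ctrOff (3 + 1) Lc) Lc u x (Sum.inl κ) (Sum.inl α)) (respStepBmSeq (d := 3) (ctr (3 + 1) Lc) Lc j)) i (k - 1 - i))
            (unitS (sfStep Lc i) (smStep 3 Lc i) (combFreshAt tabs 0 cΛ i)) κ' u'
          - push₃ (respStep (d := 3) (Lc ^ i) (Lc ^ k)) (respStep (d := 3) (Lc ^ i) (Lc ^ k)) (respStep (d := 3) (Lc ^ i) (Lc ^ k))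
            (unitS (sfStep Lc i) (smStep 3 Lc i) (combFreshAt tabs 0 cΛ i)) κ' u')) (C * (((k - i : ℕ) : ℝ) ^ p * θ ^ (k - i))) δ := by
  obtain ⟨C, θ, δ, hC, hθ, hθ1, hδ, h⟩ := exists_comb_hCg_ctr (Lc := Lc) hLc tabs hHff hrr hH cE cΛ hcE
  refine ⟨C, θ, δ, hC, hθ, hθ1, hδ, fun k i hik => locStencil_mono' (h k i hik) ?_ le_rfl⟩
  have hm : (1 : ℝ) ≤ ((k - i : ℕ) : ℝ) := by exact_mod_cast (show 1 ≤ k - i by omega)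
  exact mul_le_mul_of_nonneg_left (mul_le_mul_of_nonneg_right (pow_le_pow_right₀ hm hp) (pow_nonneg hθ _)) hC

end Summit.QuantumFields.BalabanUV.Beta.GAN24.CombBornLambdaContactBound

end
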